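import Mathlib
import Summits.ResolutionOfSingularities.ResolutionOfSingularities.Theorems.WeightedInvariantLocalWeightedDropTOT2ConflictBudgetDefs
import Summits.ResolutionOfSingularities.ResolutionOfSingularities.Theorems.WeightedInvariantLocalWeightedDropNCBranchPrimesReading

/-!
# TOT2-LINE (P3) brick B4-5: TOP-LOCUS PRIMES CORRESPOND EXACTLY UNDER THE SHEAR AND THE RE-CENTRING

Sub-problem `ResolutionOfSingularities`, ENGINE crux `stmt-ResolutionOfSingularities-8899` (`LocalWeightedDrop`), skeleton v35
(2e806da509994632), registered stub `stub_conflictBudget` (P3); typed split `L/res-L1-w43-stub-2/g6/P3_split_v1.lean` (7fbb6274b2c57d05),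
brick **B4-5** `comap_shearRecentre_mem_topPrimes` (VERBATIM) — the automorphism part of the transport of `topPrimes` (the translated point and the
graph move of the budget laws compose a chart with `recentre ψ ∘ shear3 h`).  [OURS · L1 W4.3 · chain w43 · res-L1-w43-lead-1 g6; def-free; nothing
here is a statement of any manuscript; AI-produced, gate-checked, weaker than expert review.]

`σ = recentre ψ ∘ shear3 h` (`u₂ ↦ u₂ + u₁h`, then `y ↦ y + ψ`) is a legal coordinate change with a two-sided inverse `τ`
(`NCBranchPrimes.exists_inverse_ringHom`), and `σ(monicGerm d A) = monicGerm d (shift d (shearT h A) ψ)`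
(`NCBranchPrimes.subst_recentre_subst_shear3_monicGerm`); so `σ⁻¹P′` is prime, is `≠ 𝔪` when `P′ ≠ 𝔪`, and carries the symbolic datum
`τ(s′) · monicGerm d A ∈ (σ⁻¹P′)^d` (`NCBranchPrimes.mem_pow_of_inverse`).  Also the general automorphism form `comap_mem_topPrimes_of_inverse`.
-/

set_option linter.dupNamespace false -- mandated namespace of this single-conjunct summit

noncomputable section

namespace Summit.ResolutionOfSingularities.ResolutionOfSingularities.Theorems

namespace TOT2Branch

open MvPowerSeries IsLocalRing PolyDescent MonicDescent WildMonic

variable {k : Type} [Field k]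

/-- **TOP-LOCUS PRIMES UNDER AN AUTOMORPHISM.**  If `σ` is a ring endomorphism of `k⟦u₁,u₂,y⟧` with a two-sided inverse `τ` and
`σ(monicGerm d A) = monicGerm d A′`, then `σ⁻¹` of a top-locus prime of `A′` is a top-locus prime of `A`. -/
theorem comap_mem_topPrimes_of_inverse {d : ℕ} {A A' : Fin d → MvPowerSeries (Fin 2) k}
    (σ τ : MvPowerSeries (Fin 3) k →+* MvPowerSeries (Fin 3) k) (hτσ : ∀ x, τ (σ x) = x) (hστ : ∀ x, σ (τ x) = x)
    (hσA : σ (NCPoly.monicGerm d A) = NCPoly.monicGerm d A') {P' : Ideal (MvPowerSeries (Fin 3) k)} (hP' : P' ∈ topPrimes d A') :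
    P'.comap σ ∈ topPrimes d A := by
  obtain ⟨hP'p, hP'm, s', hs', hs'F⟩ := hP'
  haveI := hP'p
  refine ⟨Ideal.comap_isPrime σ P', fun hm => hP'm ?_, τ s', ?_, ?_⟩
  · -- `σ⁻¹P′ = 𝔪 ⇒ P′ = 𝔪`
    refine le_antisymm (IsLocalRing.le_maximalIdeal hP'p.ne_top) fun q hq => ?_
    have hτq : τ q ∈ maximalIdeal (MvPowerSeries (Fin 3) k) := by
      rw [IsLocalRing.mem_maximalIdeal, mem_nonunits_iff] at hq ⊢
      intro hu
      apply hq
      have := hu.map σ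
      rwa [hστ] at this
    rw [← hm, Ideal.mem_comap, hστ] at hτq
    exact hτq
  · rw [Ideal.mem_comap, hστ]; exact hs'
  · refine NCBranchPrimes.mem_pow_of_inverse σ τ hτσ (Q := P') (fun q hq => ?_) ?_
    · rw [Ideal.mem_comap, hστ]; exact hq
    · rw [map_mul, hστ, hσA]; exact hs'F

/-- **B4-5 — SHEAR and RE-CENTRING are automorphisms: top-locus primes correspond exactly** (`P3_split_v1` VERBATIM). -/
theorem comap_shearRecentre_mem_topPrimes {d : ℕ} (A : Fin d → MvPowerSeries (Fin 2) k) (h ψ : MvPowerSeries (Fin 2) k)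
    (hψ : constantCoeff ψ = 0) {P' : Ideal (MvPowerSeries (Fin 3) k)} (hP' : P' ∈ topPrimes d (WildMonic.shift d (shearT h A) ψ)) :
    (P'.comap (substAlgHom (hasSubst_of_constantCoeff_zero (NCPoly.constantCoeff_recentre hψ)))).comap
        (substAlgHom (hasSubst_of_constantCoeff_zero (MonicDescent.constantCoeff_shear3 h))) ∈ topPrimes d A := by
  have hS1 : HasSubst (shear3 h) := hasSubst_of_constantCoeff_zero (MonicDescent.constantCoeff_shear3 h)
  have hS2 : HasSubst (NCPoly.recentre ψ) := hasSubst_of_constantCoeff_zero (NCPoly.constantCoeff_recentre hψ)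
  obtain ⟨τ₁, hτ₁l, hτ₁r⟩ := NCBranchPrimes.exists_inverse_ringHom (MonicDescent.constantCoeff_shear3 h)
    (by rw [det_linMat_shear3]; exact isUnit_one)
  obtain ⟨τ₂, hτ₂l, hτ₂r⟩ := NCBranchPrimes.exists_inverse_ringHom (NCPoly.constantCoeff_recentre hψ) (NCPoly.isUnit_det_linMat_recentre ψ)
  set σ : MvPowerSeries (Fin 3) k →+* MvPowerSeries (Fin 3) k :=
    (substAlgHom (R := k) hS2).toRingHom.comp (substAlgHom (R := k) hS1).toRingHom with hσ
  have hσapp : ∀ x, σ x = subst (NCPoly.recentre ψ) (subst (shear3 h) x) := fun x => by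
    rw [hσ, RingHom.comp_apply]
    change substAlgHom hS2 (substAlgHom hS1 x) = _
    rw [coe_substAlgHom, coe_substAlgHom]
  have hτσ : ∀ x, (τ₁.comp τ₂) (σ x) = x := fun x => by rw [hσapp, RingHom.comp_apply, hτ₂l, hτ₁l]
  have hστ : ∀ x, σ ((τ₁.comp τ₂) x) = x := fun x => by rw [hσapp, RingHom.comp_apply, hτ₁r, hτ₂r]
  have hσA : σ (NCPoly.monicGerm d A) = NCPoly.monicGerm d (WildMonic.shift d (shearT h A) ψ) := by
    rw [hσapp, NCBranchPrimes.subst_recentre_subst_shear3_monicGerm h hψ]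
  have hmem := comap_mem_topPrimes_of_inverse σ (τ₁.comp τ₂) hτσ hστ hσA hP'
  rw [hσ, ← Ideal.comap_comap] at hmem
  exact hmem

end TOT2Branch

end Summit.ResolutionOfSingularities.ResolutionOfSingularities.Theorems

end
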